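/-
Width seat `ym-line-cbag-p1-w3` (prover-ym-line-cbag-p1-w3-g8-0; own items stmt-QuantumFields-22254 `BoxFloorAllGroups` /
stmt-QuantumFields-22893 `ExpChartPackage2` CLOSED proved), helping LINE 3 `route-QuantumFields-SixPlaneColdBox`
(crux stmt-QuantumFields-25709 `DensityTransferG`, skeleton stub `stub_sixPlaneTransferWithSlackG`): the per-datum inputs of the six-plane DLR
transfer in the EXACT `(h, k, q, Φ)`-form of the law of total covariance with a datum-dependent floor
(`SixPlaneColdBox.total_covariance_lower_bound_sub_datumFloor`): six-plane sums, bilinearity done, mean smoothness summed over the planes.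
-/
import Summits.QuantumFields.YangMills.Theorems.SixPlaneColdBoxGoodDatumCovLower
import Summits.QuantumFields.YangMills.Theorems.SixPlaneColdBoxMeanSmoothPlanesG
import Summits.QuantumFields.YangMills.Theorems.ColdBoxAllGroupsBoxAllPairsCoreG
import Summits.QuantumFields.YangMills.Theorems.ColdBoxAllGroupsBulkAllGroupsKernelGoodEventG

/-!
# LINE 3 `SixPlaneColdBox`, glue: the per-datum six-plane inputs `hlow` / `hdiff` of the DLR transfer

With `F_ω-integrals` `h(ω) = E_ω F`, `k(ω) = E_ω F'`, `q(ω) = E_ω(F·F')` of the six-plane cost sums `F = Σ_{i<j} c_{(c_H;i,j)}`,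
`F' = Σ_{i<j} c_{(c_H+Te₀;i,j)}` under the box kernel `γ_ω = boxKernelG ρ β H ω` (`H = ⌈β^θ⌉`, `T = ⌈β^A⌉`, `0 < A < θ ≤ 1/200`), the law of
total covariance with a datum-dependent floor (w2, `total_covariance_lower_bound_sub_datumFloor`) needs, off the bad data: `θ₀ − Φ(ω) ≤ q − hk`
and `|k − h| ≤ ε`.  This file delivers both from the landed per-pair/per-plane statements:

* **`sixPlane_goodDatum_hlow`** — for every compact simple `G`, `r`, `0 < A < θ ≤ 1/200`: `∃ K ≥ 0, β₀`, for `β ≥ β₀` and crude-good `ω`,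
  `β²·Cov_1(F, F') − Σ_q Σ_{q'} [K·β^{−4A}·(M_q(ω) + M'_{q'}(ω)) + 2β^{−1/5}] ≤ β²·Cov_ω(F, F')`
  with the nonnegative kernel-mean excesses `M_q(ω) = β·E_ω c_{(c_H;q)} − β·E_1 c_{(c_H;q)} + 2β^{−1/4}` (and `M'` at `c_H + Te₀`), covariances spelled
  `∫FF' − ∫F∫F'` with the plane sums inside the integrals exactly as in the target `BulkDominatesBoxDensityG` and in p1's DLR pair identity
  (`sixPlane_goodDatum_cov_lower` + bilinearity `cov_sum_sum_eq`);
* **`sixPlane_goodDatum_hdiff`** — `∃ Kₛ ≥ 0, β₀`, for `β ≥ β₀` and crude-good `ω`: `|E_ω F' − E_ω F| ≤ Kₛ·β^{2(θ/5)−1}·⌈β^A⌉/⌈β^θ⌉`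
  (`goodBoundaryMeanSmoothG_allPlanes` summed over the six planes).

No sorry; no new definition; standard axioms.  NOT a claim about the Yang–Mills mass gap: glue for a LINE onto the RECORD-type node
`LatticeNonFreezing`; the line's cruxes and every summit statement remain open/untouched.
-/

set_option autoImplicit false

noncomputable section

open MeasureTheory ProbabilityTheory Finset Real Filter Topology Metric
open scoped ENNReal
open Literature.Probability.LatticeModels (Site glueWith)
open Literature.MathematicalPhysics.QuantumLattice
open Literature.MathematicalPhysics.QuantumFieldTheory
open Literature.MathematicalPhysics.QuantumFieldTheory.LatticeMaxwell
open Literature.MathematicalPhysics.QuantumFieldTheory.AxialGauge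
open Summit.QuantumFields.YangMills.Theorems.WeakCouplingRates
open Summit.QuantumFields.YangMills.Theorems.FreeEnergyLogCoefficient

namespace Summit.QuantumFields.YangMills.Theorems.ColdBoxAllGroups

/-- **`hlow` of the six-plane transfer, per crude-good datum, in `β²`-units.**  See the module docstring. -/
theorem sixPlane_goodDatum_hlow
    (G : Type) [Group G] [TopologicalSpace G] [IsTopologicalGroup G] [CompactSpace G] [MeasurableSpace G] [BorelSpace G]
    (hG : IsCompactSimpleLieGroup G) (r : LatticeRep G) {A θ : ℝ} (hA : 0 < A) (hAθ : A < θ) (hθ2 : θ ≤ 1 / 200) :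
    ∃ K : ℝ, 0 ≤ K ∧ ∃ β₀ : ℝ, ∀ β : ℝ, β₀ ≤ β → ∀ ω : LGConfig 4 G, CrudeGoodG r.ρ β (θ / 5) ⌈β ^ θ⌉₊ ω →
      (∀ q : {q : Fin 4 × Fin 4 // q.1 < q.2},
        0 ≤ β * (∫ U, plaqCostAt r.ρ (boxCentre ⌈β ^ θ⌉₊) q.1.1 q.1.2 U ∂(boxKernelG r.ρ β ⌈β ^ θ⌉₊ ω)) -
            β * (∫ U, plaqCostAt r.ρ (boxCentre ⌈β ^ θ⌉₊) q.1.1 q.1.2 U ∂(boxState r.ρ β ⌈β ^ θ⌉₊)) + 2 * β ^ (-(1 / 4 : ℝ))) ∧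
      (∀ q' : {q : Fin 4 × Fin 4 // q.1 < q.2},
        0 ≤ β * (∫ U, plaqCostAt r.ρ (boxCentre ⌈β ^ θ⌉₊ + Pi.single 0 (⌈β ^ A⌉₊ : ℤ)) q'.1.1 q'.1.2 U ∂(boxKernelG r.ρ β ⌈β ^ θ⌉₊ ω)) -
            β * (∫ U, plaqCostAt r.ρ (boxCentre ⌈β ^ θ⌉₊ + Pi.single 0 (⌈β ^ A⌉₊ : ℤ)) q'.1.1 q'.1.2 U ∂(boxState r.ρ β ⌈β ^ θ⌉₊)) +
            2 * β ^ (-(1 / 4 : ℝ))) ∧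
      β ^ 2 * ((∫ U, (∑ q : {q : Fin 4 × Fin 4 // q.1 < q.2}, plaqCostAt r.ρ (boxCentre ⌈β ^ θ⌉₊) q.1.1 q.1.2 U) *
              (∑ q : {q : Fin 4 × Fin 4 // q.1 < q.2},
                plaqCostAt r.ρ (boxCentre ⌈β ^ θ⌉₊ + Pi.single 0 (⌈β ^ A⌉₊ : ℤ)) q.1.1 q.1.2 U) ∂(boxState r.ρ β ⌈β ^ θ⌉₊)) -
            (∫ U, ∑ q : {q : Fin 4 × Fin 4 // q.1 < q.2}, plaqCostAt r.ρ (boxCentre ⌈β ^ θ⌉₊) q.1.1 q.1.2 U ∂(boxState r.ρ β ⌈β ^ θ⌉₊)) *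
              (∫ U, ∑ q : {q : Fin 4 × Fin 4 // q.1 < q.2},
                plaqCostAt r.ρ (boxCentre ⌈β ^ θ⌉₊ + Pi.single 0 (⌈β ^ A⌉₊ : ℤ)) q.1.1 q.1.2 U ∂(boxState r.ρ β ⌈β ^ θ⌉₊))) -
          (∑ q : {q : Fin 4 × Fin 4 // q.1 < q.2}, ∑ q' : {q : Fin 4 × Fin 4 // q.1 < q.2},
            (K * β ^ (-(4 * A)) *
              ((β * (∫ U, plaqCostAt r.ρ (boxCentre ⌈β ^ θ⌉₊) q.1.1 q.1.2 U ∂(boxKernelG r.ρ β ⌈β ^ θ⌉₊ ω)) -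
                  β * (∫ U, plaqCostAt r.ρ (boxCentre ⌈β ^ θ⌉₊) q.1.1 q.1.2 U ∂(boxState r.ρ β ⌈β ^ θ⌉₊)) + 2 * β ^ (-(1 / 4 : ℝ))) +
                (β * (∫ U, plaqCostAt r.ρ (boxCentre ⌈β ^ θ⌉₊ + Pi.single 0 (⌈β ^ A⌉₊ : ℤ)) q'.1.1 q'.1.2 U ∂(boxKernelG r.ρ β ⌈β ^ θ⌉₊ ω)) -
                  β * (∫ U, plaqCostAt r.ρ (boxCentre ⌈β ^ θ⌉₊ + Pi.single 0 (⌈β ^ A⌉₊ : ℤ)) q'.1.1 q'.1.2 U ∂(boxState r.ρ β ⌈β ^ θ⌉₊)) +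
                  2 * β ^ (-(1 / 4 : ℝ)))) +
              2 * β ^ (-(1 / 5 : ℝ)))) ≤
        β ^ 2 * ((∫ U, (∑ q : {q : Fin 4 × Fin 4 // q.1 < q.2}, plaqCostAt r.ρ (boxCentre ⌈β ^ θ⌉₊) q.1.1 q.1.2 U) *
              (∑ q : {q : Fin 4 × Fin 4 // q.1 < q.2},
                plaqCostAt r.ρ (boxCentre ⌈β ^ θ⌉₊ + Pi.single 0 (⌈β ^ A⌉₊ : ℤ)) q.1.1 q.1.2 U) ∂(boxKernelG r.ρ β ⌈β ^ θ⌉₊ ω)) -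
            (∫ U, ∑ q : {q : Fin 4 × Fin 4 // q.1 < q.2}, plaqCostAt r.ρ (boxCentre ⌈β ^ θ⌉₊) q.1.1 q.1.2 U ∂(boxKernelG r.ρ β ⌈β ^ θ⌉₊ ω)) *
              (∫ U, ∑ q : {q : Fin 4 × Fin 4 // q.1 < q.2},
                plaqCostAt r.ρ (boxCentre ⌈β ^ θ⌉₊ + Pi.single 0 (⌈β ^ A⌉₊ : ℤ)) q.1.1 q.1.2 U ∂(boxKernelG r.ρ β ⌈β ^ θ⌉₊ ω))) := by
  haveI := r.secondCountableTopology
  obtain ⟨K, hK0, β₀, h⟩ := sixPlane_goodDatum_cov_lower G hG r hA hAθ hθ2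
  refine ⟨K, hK0, β₀, fun β hβ ω hω => ?_⟩
  obtain ⟨h1, h2, h3⟩ := h β hβ ω hω
  refine ⟨h1, h2, ?_⟩
  haveI : IsProbabilityMeasure (boxKernelG r.ρ β ⌈β ^ θ⌉₊ ω) := isProbabilityMeasure_boxKernelG r.ρ r.continuous β _ ω
  haveI : IsProbabilityMeasure (boxState r.ρ β ⌈β ^ θ⌉₊) := isProbabilityMeasure_boxKernelG r.ρ r.continuous β _ (fun _ => 1)
  -- bilinearity under both measures
  have hbil : ∀ (μ : Measure (LGConfig 4 G)) [IsProbabilityMeasure μ],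
      (∫ U, (∑ q : {q : Fin 4 × Fin 4 // q.1 < q.2}, plaqCostAt r.ρ (boxCentre ⌈β ^ θ⌉₊) q.1.1 q.1.2 U) *
          (∑ q : {q : Fin 4 × Fin 4 // q.1 < q.2}, plaqCostAt r.ρ (boxCentre ⌈β ^ θ⌉₊ + Pi.single 0 (⌈β ^ A⌉₊ : ℤ)) q.1.1 q.1.2 U) ∂μ) -
        (∫ U, ∑ q : {q : Fin 4 × Fin 4 // q.1 < q.2}, plaqCostAt r.ρ (boxCentre ⌈β ^ θ⌉₊) q.1.1 q.1.2 U ∂μ) *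
          (∫ U, ∑ q : {q : Fin 4 × Fin 4 // q.1 < q.2}, plaqCostAt r.ρ (boxCentre ⌈β ^ θ⌉₊ + Pi.single 0 (⌈β ^ A⌉₊ : ℤ)) q.1.1 q.1.2 U ∂μ) =
      ∑ q : {q : Fin 4 × Fin 4 // q.1 < q.2}, ∑ q' : {q : Fin 4 × Fin 4 // q.1 < q.2},
        ((∫ U, plaqCostAt r.ρ (boxCentre ⌈β ^ θ⌉₊) q.1.1 q.1.2 U *
            plaqCostAt r.ρ (boxCentre ⌈β ^ θ⌉₊ + Pi.single 0 (⌈β ^ A⌉₊ : ℤ)) q'.1.1 q'.1.2 U ∂μ) -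
          (∫ U, plaqCostAt r.ρ (boxCentre ⌈β ^ θ⌉₊) q.1.1 q.1.2 U ∂μ) *
            (∫ U, plaqCostAt r.ρ (boxCentre ⌈β ^ θ⌉₊ + Pi.single 0 (⌈β ^ A⌉₊ : ℤ)) q'.1.1 q'.1.2 U ∂μ)) := by
    intro μ _
    exact cov_sum_sum_eq μ _ _
      (fun q => integrable_plaqCostAt_of_rep r.ρ r.continuous r.mem_unitary _ _ _ μ)
      (fun q => integrable_plaqCostAt_of_rep r.ρ r.continuous r.mem_unitary _ _ _ μ)
      (fun q q' => integrable_plaqCostAt_mul_of_rep' r.ρ r.continuous r.mem_unitary _ _ _ _ _ _ μ)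
  rw [hbil (boxState r.ρ β ⌈β ^ θ⌉₊), hbil (boxKernelG r.ρ β ⌈β ^ θ⌉₊ ω), Finset.mul_sum, Finset.mul_sum, ← Finset.sum_sub_distrib]
  refine le_of_eq_of_le ?_ (h3.trans_eq ?_)
  · refine Finset.sum_congr rfl fun q _ => ?_
    rw [Finset.mul_sum, ← Finset.sum_sub_distrib]
    refine Finset.sum_congr rfl fun q' _ => ?_
    ring
  · refine Finset.sum_congr rfl fun q _ => ?_
    rw [Finset.mul_sum]

/-- **`hdiff` of the six-plane transfer, per crude-good datum**: the six-plane kernel means at `c_H + Te₀` and at `c_H` differ by at most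
`Kₛ·β^{2(θ/5)−1}·⌈β^A⌉/⌈β^θ⌉` (L1b-G summed over the planes). -/
theorem sixPlane_goodDatum_hdiff
    (G : Type) [Group G] [TopologicalSpace G] [IsTopologicalGroup G] [CompactSpace G] [MeasurableSpace G] [BorelSpace G]
    (hG : IsCompactSimpleLieGroup G) (r : LatticeRep G) {A θ : ℝ} (hA : 0 < A) (hAθ : A < θ) (hθ2 : θ ≤ 1 / 200) :
    ∃ Kₛ : ℝ, 0 ≤ Kₛ ∧ ∃ β₀ : ℝ, ∀ β : ℝ, β₀ ≤ β → ∀ ω : LGConfig 4 G, CrudeGoodG r.ρ β (θ / 5) ⌈β ^ θ⌉₊ ω →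
      |(∫ U, ∑ q : {q : Fin 4 × Fin 4 // q.1 < q.2},
            plaqCostAt r.ρ (boxCentre ⌈β ^ θ⌉₊ + Pi.single 0 (⌈β ^ A⌉₊ : ℤ)) q.1.1 q.1.2 U ∂(boxKernelG r.ρ β ⌈β ^ θ⌉₊ ω)) -
          (∫ U, ∑ q : {q : Fin 4 × Fin 4 // q.1 < q.2}, plaqCostAt r.ρ (boxCentre ⌈β ^ θ⌉₊) q.1.1 q.1.2 U ∂(boxKernelG r.ρ β ⌈β ^ θ⌉₊ ω))|
        ≤ Kₛ * β ^ (2 * (θ / 5) - 1) * (⌈β ^ A⌉₊ : ℝ) / (⌈β ^ θ⌉₊ : ℝ) := by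
  haveI := r.secondCountableTopology
  have hpl := fun q : {q : Fin 4 × Fin 4 // q.1 < q.2} => goodBoundaryMeanSmoothG_allPlanes G hG r hA hAθ hθ2 q.1.1 q.1.2 q.2
  choose Kq βq hq using hpl
  refine ⟨∑ q, |Kq q|, Finset.sum_nonneg fun q _ => abs_nonneg _, ∑ q, |βq q|, fun β hβ ω hω => ?_⟩
  haveI : IsProbabilityMeasure (boxKernelG r.ρ β ⌈β ^ θ⌉₊ ω) := isProbabilityMeasure_boxKernelG r.ρ r.continuous β _ ω
  have hb : ∀ q, βq q ≤ β := fun q =>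
    ((le_abs_self _).trans (Finset.single_le_sum (f := fun q => |βq q|) (fun q _ => abs_nonneg _) (Finset.mem_univ q))).trans hβ
  have hnum : 0 ≤ β ^ (2 * (θ / 5) - 1) * (⌈β ^ A⌉₊ : ℝ) / (⌈β ^ θ⌉₊ : ℝ) := by
    have hβ0 : 0 ≤ β := le_trans (Finset.sum_nonneg fun q _ => abs_nonneg (βq q)) hβ
    positivity
  rw [integral_finsetSum _ fun q _ => integrable_plaqCostAt_of_rep r.ρ r.continuous r.mem_unitary _ _ _ _,
    integral_finsetSum _ fun q _ => integrable_plaqCostAt_of_rep r.ρ r.continuous r.mem_unitary _ _ _ _,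
    ← Finset.sum_sub_distrib]
  refine (Finset.abs_sum_le_sum_abs _ _).trans ?_
  have e : (∑ q : {q : Fin 4 × Fin 4 // q.1 < q.2}, |Kq q|) * β ^ (2 * (θ / 5) - 1) * (⌈β ^ A⌉₊ : ℝ) / (⌈β ^ θ⌉₊ : ℝ) =
      ∑ q : {q : Fin 4 × Fin 4 // q.1 < q.2}, |Kq q| * (β ^ (2 * (θ / 5) - 1) * (⌈β ^ A⌉₊ : ℝ) / (⌈β ^ θ⌉₊ : ℝ)) := by
    rw [Finset.sum_mul, Finset.sum_mul, Finset.sum_div]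
    exact Finset.sum_congr rfl fun q _ => by ring
  rw [e]
  refine Finset.sum_le_sum fun q _ => ?_
  have h := hq q β (hb q) ω hω
  calc _ ≤ Kq q * β ^ (2 * (θ / 5) - 1) * (⌈β ^ A⌉₊ : ℝ) / (⌈β ^ θ⌉₊ : ℝ) := h
    _ = Kq q * (β ^ (2 * (θ / 5) - 1) * (⌈β ^ A⌉₊ : ℝ) / (⌈β ^ θ⌉₊ : ℝ)) := by ring
    _ ≤ |Kq q| * (β ^ (2 * (θ / 5) - 1) * (⌈β ^ A⌉₊ : ℝ) / (⌈β ^ θ⌉₊ : ℝ)) :=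
        mul_le_mul_of_nonneg_right (le_abs_self _) hnum

end Summit.QuantumFields.YangMills.Theorems.ColdBoxAllGroups

end
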